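import Literature.AlgebraicGeometry.Motives.HodgeStructureLefschetzGroupInvariantsHodgeClasses
import Literature.AlgebraicGeometry.Motives.HodgeStructureLefschetzGroupPowersInvariantsRational
import HarnessLib

/-!
# Milne 1999 §5 Prop. 5.1 on the abstract polarized `ℚ`-Hodge structure of odd weight: `D(A)` IS A GRADED SUBALGEBRA —
# `ℚ[B¹] = ⨁_p Dᵖ` inside `⋀_ℚ V`; "`H^{2g}(A)(g)` consists of Lefschetz classes" (`D^g = ⋀^{2g} V`); and the RATIONAL points:
# Lefschetz classes are fixed by `S(H)(ℚ)`

[topic AlgebraicGeometry/Motives]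

Layer `Literature/AlgebraicGeometry/Motives`, lane `lit-hodgefound` (Track 2 foundations library; seat `lit-hodgefound-p34`,
generation 26, self-proposed row g26-#4 of `run/shared/lean/pub/lit-hodgefound/SKELETON.md`). THEOREMS ONLY (no definition,
no named fact; net debt `0`). Sequel of g26-#1 `Motives/HodgeStructureLefschetzGroupInvariantsHodgeClasses` (Cor. 4.5 on the
carrier: the rational classes with `S(H)(ℂ)`-invariant complexification are `⨁_p Dᵖ = ℚ[B¹]`). CARRIER: as there — `H` pure of
odd weight `n` on `V` with a polarization `Q`, `Θ = toComplexAlg V`, `S(H)(ℂ) = Q.lefschetzGroupBaseChange ℂ` and its RATIONAL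
points `S(H)(ℚ) = Q.lefschetzGroup` (g18-#1), `B¹ = (H.exteriorPower 2).hodgeClasses n`, `Dᵖ = H.divisorClasses p ⊆ ⋀[ℚ]^{2p} V`.

## The source, verbatim

J. S. Milne, *Lefschetz classes on abelian varieties*, Duke Math. J. **96** (1999) 639–675 [Milne1999LefschetzClasses] (held
`paper:doi-10-1215-s0012-7094-99-09620-5`; PDF page = printed page − 638). p0024 L30–L41 (p. 662): "**Proposition 5.1.** For
any abelian variety `A`, `D_hom(A)_k` is a graded subalgebra of `H^{2*}(A)(*)`, i.e., if `α ∈ D_hom(A)_k` and `α = Σ α_r` with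
`α_r ∈ H^{2r}(A)(r)`, then `α_r ∈ D_hom(A)_k`. Proof. […] Define `w : 𝔾_m → GL(V(A))` to be the homomorphism such that
`w(c)x = c⁻¹x` […] Then `w(c)α = Σ c^r α_r` all `c ∈ k^×`, and this equation determines the `α_r` uniquely. Since the action
of `w(𝔾_m)` commutes with that of `S(A)`, this shows that if `α` is fixed by `S(A)` then so also are the `α_r`. Now we can apply
Theorem 3.2 to complete the proof." p0025 L27–L29 (p. 663): "Because `H^{2g}(A)(g)` consists of Lefschetz classes—it is
generated by the class of `D^g` for any ample divisor `D` on `A`—the action of `L(A)` on it is trivial." p0014 L78–L80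
(p. 652): "When `G(k)` is Zariski dense in `G_{/k^{al}}` […] `V^G` is the space of vectors in `V` fixed by the elements of
`G(k)`." (here only the inclusion `G(k) ⊆ G(k^{al})` is used: invariants are fixed by the rational points.)

## What is PROVED (`Θ = toComplexAlg V`; odd weight unless marked)

* §1 NATURALITY OF `Θ` (any `ℚ`-linear `f : V → W`): `ExteriorLefschetz.toComplexAlg_map`
  (`Θ_W (⋀(f) x) = ⋀(f_ℂ)(Θ_V x)`).
* §2 PROP. 5.1 — `D(A)` IS GRADED: `Polarization.coe_decompose_mem_map_divisorClasses_of_forall_lefschetzGroupBaseChange_map_toComplexAlg_eq`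
  (if `Θ x` is `S(H)(ℂ)`-invariant, the degree-`2p` component of `x` is a divisor class: `x_{2p} ∈ Dᵖ`) and
  `…decompose_eq_zero_of_forall_…_of_odd` (its odd components vanish) — "if `α` is fixed by `S(A)` then so also are the `α_r`"
  (the tree's `Milne1999.map_decompose_eq_of_map_eq`: `⋀(γ)` respects the grading) + Cor. 4.5;
  **`Polarization.toSubmodule_adjoin_hodgeClasses_two_eq_iSup_map_divisorClasses`** (`ℚ[B¹] = ⨆_p Dᵖ` inside `⋀_ℚ V`: the
  `ℚ`-algebra generated by the degree-two Hodge classes is the direct sum of Lange's `Dᵖ`),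
  `…mem_map_divisorClasses_of_mem_adjoin_hodgeClasses_two` (a HOMOGENEOUS element of `ℚ[B¹]` of degree `2p` lies in `Dᵖ`).
* §3 "`H^{2g}(A)(g)` CONSISTS OF LEFSCHETZ CLASSES": **`Polarization.divisorClasses_eq_top_of_finrank_eq`** (`dim V = 2g ⟹
  D^g = ⋀^{2g} V`, spanned by `E_Q^g ≠ 0`), `…forall_lefschetzGroupBaseChange_map_toComplexAlg_eq_of_mem_exteriorPower_finrank`
  ("the action of `L(A)` on it is trivial": `S(H)(ℂ)` fixes `Θ(⋀^{2g}_ℚ V)`).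
* §4 RATIONAL POINTS: `Polarization.map_eq_of_mem_lefschetzGroup_of_forall_lefschetzGroupBaseChange_map_toComplexAlg_eq`
  (any weight: a rational class with `S(H)(ℂ)`-invariant complexification is fixed by every `g ∈ S(H)(ℚ)`, `Θ` injective and
  natural), **`Polarization.exteriorPower_map_eq_of_mem_lefschetzGroup_of_mem_divisorClasses`** (`x ∈ Dᵖ`, `g ∈ S(H)(ℚ) ⟹
  ⋀^{2p}(g) x = x`), `…map_eq_of_mem_lefschetzGroup_of_mem_adjoin_hodgeClasses_two` (all of `ℚ[B¹]`),
  `…exteriorPower_map_eq_of_mem_lefschetzGroup_of_mem_hodgeClasses_two` (`B¹` itself).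

## Lean encoding, differences

Milne's proof of Prop. 5.1 separates the homogeneous components with the weight cocharacter `w`; on the carrier the grading of
`⋀_ℚ V = ⨁_i ⋀ⁱ V` is available directly (`DirectSum.decompose`) and `⋀(γ)`, `Θ` respect it, which is the same argument. The
converse of §4 ("fixed by `S(H)(ℚ)` ⟹ Lefschetz") would need Zariski density of `S(H)(ℚ)` (false in general: `S(A)` may be
disconnected) — NOT claimed.

## References
* [Milne1999LefschetzClasses] J. S. Milne, *Lefschetz classes on abelian varieties*, Duke Math. J. 96 (1999), §5 Prop. 5.1
  (p. 662), p. 663 L27–L29; §3 p. 652 L78–L80, Thm. 3.2; §4 Cor. 4.5.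
* [Lange2023AbelianVarietiesComplex] H. Lange, *Abelian Varieties over the Complex Numbers* (2023), §7.3.1 (`D•`), §7.3.2
  Lemma 7.3.6 (`E^g ≠ 0`).
* [BourbakiAlgebre1a3] N. Bourbaki, *Algèbre* Ch. III §7 no. 2, no. 5 Prop. 8 (functoriality and base change of `⋀`).
-/

open scoped TensorProduct
open DirectSum

namespace Literature.AlgebraicGeometry.Motives

/-! ### §1 Naturality of `Θ = toComplexAlg` -/

namespace ExteriorLefschetz

open ExteriorAlgebra

universe u v

variable {V : Type u} [AddCommGroup V] [Module ℚ V] {W : Type v} [AddCommGroup W] [Module ℚ W]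

/-- **`Θ` is natural**: `Θ_W(⋀(f) x) = ⋀(f_ℂ)(Θ_V x)` for a `ℚ`-linear `f : V → W` (both sides are algebra maps agreeing on
`ι v ↦ ι(1 ⊗ f v)`). [cite: BourbakiAlgebre1a3, Ch. III §7 no. 2 and no. 5 Prop. 8] -/
theorem toComplexAlg_map (f : V →ₗ[ℚ] W) (x : ExteriorAlgebra ℚ V) :
    toComplexAlg W (ExteriorAlgebra.map f x) = ExteriorAlgebra.map (f.baseChange ℂ) (toComplexAlg V x) := by
  induction x using ExteriorAlgebra.induction with
  | algebraMap r =>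
    simp only [AlgHom.commutes]
    rw [IsScalarTower.algebraMap_apply ℚ ℂ (ExteriorAlgebra ℂ (ℂ ⊗[ℚ] V)), AlgHom.commutes,
      ← IsScalarTower.algebraMap_apply]
  | ι v => rw [ExteriorAlgebra.map_apply_ι, toComplexAlg_ι, toComplexAlg_ι, ExteriorAlgebra.map_apply_ι,
      LinearMap.baseChange_tmul]
  | mul a b ha hb => rw [map_mul, map_mul, ha, hb, map_mul, map_mul]
  | add a b ha hb => rw [map_add, map_add, ha, hb, map_add, map_add]

end ExteriorLefschetz

namespace HodgeStructure

open ExteriorLefschetz ExteriorAlgebra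

universe u

variable {V : Type u} [AddCommGroup V] [Module ℚ V] [Module.Finite ℚ V] {n : ℤ} {H : HodgeStructure V n}
  (Q : Polarization H)

/-! ### §2 Prop. 5.1: `D(A)` is a graded subalgebra — `ℚ[B¹] = ⨁_p Dᵖ` -/

/-- **"If `α` is fixed by `S(A)` then so also are the `α_r`", hence `α_r ∈ D^r`**: if `Θ x` is fixed by `S(H)(ℂ)`, then for
every `p` the degree-`2p` homogeneous component `x_{2p}` of `x ∈ ⋀_ℚ V` is a divisor class, `x_{2p} ∈ Dᵖ` (`⋀(γ)` and `Θ`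
respect the grading of `⋀`, the tree's `Milne1999.map_decompose_eq_of_map_eq` and g25-#6 `coe_decompose_toComplexAlg`; then
Cor. 4.5 of g26-#1). [cite: Milne1999LefschetzClasses, §5 Prop. 5.1 (p. 662)] -/
theorem Polarization.coe_decompose_mem_map_divisorClasses_of_forall_lefschetzGroupBaseChange_map_toComplexAlg_eq
    (hn : Odd n) {x : ExteriorAlgebra ℚ V}
    (hx : ∀ γ ∈ Q.lefschetzGroupBaseChange ℂ,
      ExteriorAlgebra.map (γ : ℂ ⊗[ℚ] V →ₗ[ℂ] ℂ ⊗[ℚ] V) (toComplexAlg V x) = toComplexAlg V x) (p : ℕ) :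
    ((decompose (fun i : ℕ => ⋀[ℚ]^i V) x (2 * p) : ⋀[ℚ]^(2 * p) V) : ExteriorAlgebra ℚ V) ∈
      (H.divisorClasses p).map (⋀[ℚ]^(2 * p) V).subtype := by
  classical
  have h : ((decompose (fun i : ℕ => ⋀[ℚ]^i V) x (2 * p) : ⋀[ℚ]^(2 * p) V) : ExteriorAlgebra ℚ V) ∈
      {x : ExteriorAlgebra ℚ V | x ∈ ⋀[ℚ]^(2 * p) V ∧ ∀ γ ∈ Q.lefschetzGroupBaseChange ℂ,
        ExteriorAlgebra.map (γ : ℂ ⊗[ℚ] V →ₗ[ℂ] ℂ ⊗[ℚ] V) (toComplexAlg V x) = toComplexAlg V x} := by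
    refine ⟨(decompose (fun i : ℕ => ⋀[ℚ]^i V) x (2 * p)).2, fun γ hγ ↦ ?_⟩
    rw [← coe_decompose_toComplexAlg]
    exact Milne1999.map_decompose_eq_of_map_eq (γ : ℂ ⊗[ℚ] V →ₗ[ℂ] ℂ ⊗[ℚ] V) (hx γ hγ) (2 * p)
  rw [Q.setOf_mem_and_forall_lefschetzGroupBaseChange_map_toComplexAlg_eq_eq_map_divisorClasses hn p] at h
  exact h

/-- The membership form in `Dᵖ` itself: the degree-`2p` component of a rational class with `S(H)(ℂ)`-invariant
complexification is a divisor class. [cite: Milne1999LefschetzClasses, §5 Prop. 5.1 (p. 662)] -/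
theorem Polarization.decompose_mem_divisorClasses_of_forall_lefschetzGroupBaseChange_map_toComplexAlg_eq (hn : Odd n)
    {x : ExteriorAlgebra ℚ V}
    (hx : ∀ γ ∈ Q.lefschetzGroupBaseChange ℂ,
      ExteriorAlgebra.map (γ : ℂ ⊗[ℚ] V →ₗ[ℂ] ℂ ⊗[ℚ] V) (toComplexAlg V x) = toComplexAlg V x) (p : ℕ) :
    decompose (fun i : ℕ => ⋀[ℚ]^i V) x (2 * p) ∈ H.divisorClasses p := by
  obtain ⟨y, hy, hyx⟩ :=
    Q.coe_decompose_mem_map_divisorClasses_of_forall_lefschetzGroupBaseChange_map_toComplexAlg_eq hn hx p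
  rwa [← Subtype.ext hyx]

omit [Module.Finite ℚ V] in
/-- **Odd components vanish**: if `Θ x` is fixed by `S(H)(ℂ)`, the degree-`2p+1` components of `x` are `0` (`−1 ∈ S(H)(ℂ)`;
g25-#6 `eq_zero_of_forall_lefschetzGroupBaseChange_map_toComplexAlg_eq_of_odd`). [cite: Milne1999LefschetzClasses, §5 Prop. 5.1 (p. 662) and §3 p. 654] -/
theorem Polarization.decompose_eq_zero_of_forall_lefschetzGroupBaseChange_map_toComplexAlg_eq_of_odd
    {x : ExteriorAlgebra ℚ V}
    (hx : ∀ γ ∈ Q.lefschetzGroupBaseChange ℂ,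
      ExteriorAlgebra.map (γ : ℂ ⊗[ℚ] V →ₗ[ℂ] ℂ ⊗[ℚ] V) (toComplexAlg V x) = toComplexAlg V x) (p : ℕ) :
    decompose (fun i : ℕ => ⋀[ℚ]^i V) x (2 * p + 1) = 0 := by
  classical
  refine Subtype.ext ?_
  rw [ZeroMemClass.coe_zero]
  refine Q.eq_zero_of_forall_lefschetzGroupBaseChange_map_toComplexAlg_eq_of_odd ⟨p, rfl⟩
    (decompose (fun i : ℕ => ⋀[ℚ]^i V) x (2 * p + 1)).2 fun γ hγ ↦ ?_
  rw [← coe_decompose_toComplexAlg]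
  exact Milne1999.map_decompose_eq_of_map_eq (γ : ℂ ⊗[ℚ] V →ₗ[ℂ] ℂ ⊗[ℚ] V) (hx γ hγ) (2 * p + 1)

include Q in
/-- **Milne 1999, Prop. 5.1 on the carrier: `D(A)` is a GRADED subalgebra — `ℚ[B¹] = ⨁_p Dᵖ`.** Inside `⋀_ℚ V`, the
`ℚ`-subalgebra generated by the degree-two Hodge classes `B¹ = Hdgⁿ(⋀² H)` (= the rational classes with `S(H)(ℂ)`-invariant
complexification, g26-#1) is, as a `ℚ`-subspace, the sum of (the images of) Lange's `Dᵖ = H.divisorClasses p` over all `p`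
(odd weight). [cite: Milne1999LefschetzClasses, §5 Prop. 5.1 (p. 662)] [cite: Lange2023AbelianVarietiesComplex, §7.3.1] -/
theorem Polarization.toSubmodule_adjoin_hodgeClasses_two_eq_iSup_map_divisorClasses (hn : Odd n) :
    Subalgebra.toSubmodule (Algebra.adjoin ℚ (((H.exteriorPower 2).hodgeClasses n).map (⋀[ℚ]^2 V).subtype :
        Set (ExteriorAlgebra ℚ V))) =
      ⨆ p : ℕ, (H.divisorClasses p).map (⋀[ℚ]^(2 * p) V).subtype := by
  classical
  refine le_antisymm (fun x hx ↦ ?_) (iSup_le fun p x hx ↦ ?_)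
  · have hx' : x ∈ {x : ExteriorAlgebra ℚ V | ∀ γ ∈ Q.lefschetzGroupBaseChange ℂ,
        ExteriorAlgebra.map (γ : ℂ ⊗[ℚ] V →ₗ[ℂ] ℂ ⊗[ℚ] V) (toComplexAlg V x) = toComplexAlg V x} := by
      rw [Q.setOf_forall_lefschetzGroupBaseChange_map_toComplexAlg_eq_eq_adjoin_hodgeClasses_two hn]
      exact hx
    rw [← sum_support_decompose (fun i : ℕ => ⋀[ℚ]^i V) x]
    refine Submodule.sum_mem _ fun i _ ↦ ?_
    obtain ⟨p, rfl | rfl⟩ := Nat.even_or_odd' i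
    · exact Submodule.mem_iSup_of_mem p
        (Q.coe_decompose_mem_map_divisorClasses_of_forall_lefschetzGroupBaseChange_map_toComplexAlg_eq hn hx' p)
    · rw [Q.decompose_eq_zero_of_forall_lefschetzGroupBaseChange_map_toComplexAlg_eq_of_odd hx' p, ZeroMemClass.coe_zero]
      exact Submodule.zero_mem _
  · have hx' : x ∈ {x : ExteriorAlgebra ℚ V | ∀ γ ∈ Q.lefschetzGroupBaseChange ℂ,
        ExteriorAlgebra.map (γ : ℂ ⊗[ℚ] V →ₗ[ℂ] ℂ ⊗[ℚ] V) (toComplexAlg V x) = toComplexAlg V x} := by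
      rw [← Q.span_divisorTwoVectors_pow_eq_map_divisorClasses hn p] at hx
      exact Q.forall_lefschetzGroupBaseChange_map_toComplexAlg_eq_of_mem_span_pow hn p hx
    rw [Q.setOf_forall_lefschetzGroupBaseChange_map_toComplexAlg_eq_eq_adjoin_hodgeClasses_two hn] at hx'
    exact hx'

include Q in
/-- **A homogeneous element of `ℚ[B¹]` of degree `2p` is a divisor class** ("if `α ∈ D_hom(A)_k` and `α = Σ α_r` … then
`α_r ∈ D_hom(A)_k`", read for a single degree): for `x ∈ ⋀^{2p}_ℚ V` in the subalgebra generated by `B¹`, `x ∈ Dᵖ` (odd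
weight). [cite: Milne1999LefschetzClasses, §5 Prop. 5.1 (p. 662)] -/
theorem Polarization.mem_divisorClasses_of_mem_adjoin_hodgeClasses_two (hn : Odd n) {p : ℕ} {x : ⋀[ℚ]^(2 * p) V}
    (hx : (x : ExteriorAlgebra ℚ V) ∈ Algebra.adjoin ℚ (((H.exteriorPower 2).hodgeClasses n).map (⋀[ℚ]^2 V).subtype :
        Set (ExteriorAlgebra ℚ V))) :
    x ∈ H.divisorClasses p := by
  have hx' : (x : ExteriorAlgebra ℚ V) ∈ {x : ExteriorAlgebra ℚ V | ∀ γ ∈ Q.lefschetzGroupBaseChange ℂ,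
      ExteriorAlgebra.map (γ : ℂ ⊗[ℚ] V →ₗ[ℂ] ℂ ⊗[ℚ] V) (toComplexAlg V x) = toComplexAlg V x} := by
    rw [Q.setOf_forall_lefschetzGroupBaseChange_map_toComplexAlg_eq_eq_adjoin_hodgeClasses_two hn]
    exact hx
  exact (Q.forall_lefschetzGroupBaseChange_map_toComplexAlg_eq_iff_mem_divisorClasses hn x).1 hx'

/-! ### §3 "`H^{2g}(A)(g)` consists of Lefschetz classes": `D^g = ⋀^{2g} V` -/

include Q in
/-- **`D^g = ⋀^{2g} V` for `dim V = 2g`** ("`H^{2g}(A)(g)` consists of Lefschetz classes—it is generated by the class of `D^g`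
for any ample divisor `D` on `A`"): `⋀^{2g} V` is a line (`dim = C(2g, 2g) = 1`) containing the divisor class `E_Q^g ≠ 0`
(p02's `lefschetzClass_pow_ne_zero`, p29's `powOf_mem_divisorClasses`). Odd weight (so that `E_Q` is symplectic).
[cite: Milne1999LefschetzClasses, §5 p. 663 L27–L29] [cite: Lange2023AbelianVarietiesComplex, §7.3.2 Lemma 7.3.6] -/
theorem Polarization.divisorClasses_eq_top_of_finrank_eq (hn : Odd n) {g : ℕ} (hg : Module.finrank ℚ V = 2 * g) :
    H.divisorClasses g = ⊤ := by
  have hmem : powOf Q.lefschetzClass g rfl ∈ H.divisorClasses g :=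
    H.powOf_mem_divisorClasses Q.lefschetzClass_mem_hodgeClasses g
  have hne : powOf Q.lefschetzClass g rfl ≠ 0 := fun h ↦ Q.lefschetzClass_pow_ne_zero hn hg (by
    rw [← coe_powOf Q.lefschetzClass g rfl, h, ZeroMemClass.coe_zero])
  have h1 : Module.finrank ℚ (⋀[ℚ]^(2 * g) V) = 1 := by
    rw [exteriorPower.finrank_eq, hg, Nat.choose_self]
  refine Submodule.eq_top_of_finrank_eq (le_antisymm (Submodule.finrank_le _) ?_)
  rw [h1, ← finrank_span_singleton (K := ℚ) hne]
  exact Submodule.finrank_mono ((Submodule.span_singleton_le_iff_mem _ _).2 hmem)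

include Q in
/-- Every top-degree class is a divisor class (`dim V = 2g`, odd weight). [cite: Milne1999LefschetzClasses, §5 p. 663 L27–L29] -/
theorem Polarization.mem_divisorClasses_of_finrank_eq (hn : Odd n) {g : ℕ} (hg : Module.finrank ℚ V = 2 * g)
    (x : ⋀[ℚ]^(2 * g) V) : x ∈ H.divisorClasses g := by
  rw [Q.divisorClasses_eq_top_of_finrank_eq hn hg]
  exact Submodule.mem_top

/-- **"the action of `L(A)` on `H^{2g}(A)(g)` is trivial"**: for `dim V = 2g` and `x ∈ ⋀^{2g}_ℚ V`, `Θ x` is fixed by every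
`γ ∈ S(H)(ℂ)` (top-degree classes are Lefschetz, Cor. 4.5; equivalently `det γ = 1` on `S(H) ⊆ Sp`). Odd weight.
[cite: Milne1999LefschetzClasses, §5 p. 663 L27–L29] -/
theorem Polarization.forall_lefschetzGroupBaseChange_map_toComplexAlg_eq_of_mem_exteriorPower_finrank (hn : Odd n) {g : ℕ}
    (hg : Module.finrank ℚ V = 2 * g) (x : ⋀[ℚ]^(2 * g) V) :
    ∀ γ ∈ Q.lefschetzGroupBaseChange ℂ,
      ExteriorAlgebra.map (γ : ℂ ⊗[ℚ] V →ₗ[ℂ] ℂ ⊗[ℚ] V) (toComplexAlg V (x : ExteriorAlgebra ℚ V)) =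
        toComplexAlg V (x : ExteriorAlgebra ℚ V) :=
  (Q.forall_lefschetzGroupBaseChange_map_toComplexAlg_eq_iff_mem_divisorClasses hn x).2
    (Q.mem_divisorClasses_of_finrank_eq hn hg x)

/-! ### §4 Rational points: Lefschetz classes are fixed by `S(H)(ℚ)` -/

omit [Module.Finite ℚ V] in
/-- **Invariants are fixed by the rational points** (any weight): if `Θ x` is fixed by every `γ ∈ S(H)(ℂ)`, then `⋀(g) x = x`
for every `g ∈ S(H)(ℚ) = Q.lefschetzGroup` — `g_ℂ = 1 ⊗ g ∈ S(H)(ℂ)` (g18-#1 `lefschetzGroup_le_comap_lefschetzGroupBaseChange`),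
`Θ(⋀(g) x) = ⋀(g_ℂ)(Θ x)` (§1) and `Θ` is injective (g25-#7). [cite: Milne1999LefschetzClasses, §3 p. 652 L78–L80] -/
theorem Polarization.map_eq_of_mem_lefschetzGroup_of_forall_lefschetzGroupBaseChange_map_toComplexAlg_eq
    {x : ExteriorAlgebra ℚ V}
    (hx : ∀ γ ∈ Q.lefschetzGroupBaseChange ℂ,
      ExteriorAlgebra.map (γ : ℂ ⊗[ℚ] V →ₗ[ℂ] ℂ ⊗[ℚ] V) (toComplexAlg V x) = toComplexAlg V x)
    {g : V ≃ₗ[ℚ] V} (hg : g ∈ Q.lefschetzGroup) :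
    ExteriorAlgebra.map (g : V →ₗ[ℚ] V) x = x := by
  have hγ := Q.lefschetzGroup_le_comap_lefschetzGroupBaseChange ℂ hg
  rw [Subgroup.mem_comap, glBaseChange_apply] at hγ
  have h := hx _ hγ
  rw [LinearEquiv.coe_baseChange] at h
  apply toComplexAlg_injective V
  rw [toComplexAlg_map, h]

/-- **Lefschetz classes are fixed by `S(H)(ℚ)`**: for `x ∈ Dᵖ` and `g ∈ S(H)(ℚ)`, `⋀^{2p}(g) x = x` (odd weight; Cor. 4.5 of
g26-#1 and the previous theorem). [cite: Milne1999LefschetzClasses, §4 Cor. 4.5 (p. 659) and §3 p. 652 L78–L80] -/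
theorem Polarization.exteriorPower_map_eq_of_mem_lefschetzGroup_of_mem_divisorClasses (hn : Odd n) {p : ℕ}
    {x : ⋀[ℚ]^(2 * p) V} (hx : x ∈ H.divisorClasses p) {g : V ≃ₗ[ℚ] V} (hg : g ∈ Q.lefschetzGroup) :
    exteriorPower.map (2 * p) (g : V →ₗ[ℚ] V) x = x := by
  refine Subtype.ext ?_
  rw [coe_exteriorPower_map]
  exact Q.map_eq_of_mem_lefschetzGroup_of_forall_lefschetzGroupBaseChange_map_toComplexAlg_eq
    ((Q.forall_lefschetzGroupBaseChange_map_toComplexAlg_eq_iff_mem_divisorClasses hn x).2 hx) hg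

/-- **All of `D(A) = ℚ[B¹]` is fixed by `S(H)(ℚ)`** (odd weight): for `x` in the `ℚ`-subalgebra of `⋀_ℚ V` generated by the
degree-two Hodge classes and `g ∈ S(H)(ℚ)`, `⋀(g) x = x`. [cite: Milne1999LefschetzClasses, §4 Cor. 4.5 (p. 659) and §3 p. 652 L78–L80] -/
theorem Polarization.map_eq_of_mem_lefschetzGroup_of_mem_adjoin_hodgeClasses_two (hn : Odd n) {x : ExteriorAlgebra ℚ V}
    (hx : x ∈ Algebra.adjoin ℚ (((H.exteriorPower 2).hodgeClasses n).map (⋀[ℚ]^2 V).subtype : Set (ExteriorAlgebra ℚ V)))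
    {g : V ≃ₗ[ℚ] V} (hg : g ∈ Q.lefschetzGroup) :
    ExteriorAlgebra.map (g : V →ₗ[ℚ] V) x = x := by
  have hx' : x ∈ {x : ExteriorAlgebra ℚ V | ∀ γ ∈ Q.lefschetzGroupBaseChange ℂ,
      ExteriorAlgebra.map (γ : ℂ ⊗[ℚ] V →ₗ[ℂ] ℂ ⊗[ℚ] V) (toComplexAlg V x) = toComplexAlg V x} := by
    rw [Q.setOf_forall_lefschetzGroupBaseChange_map_toComplexAlg_eq_eq_adjoin_hodgeClasses_two hn]
    exact hx
  exact Q.map_eq_of_mem_lefschetzGroup_of_forall_lefschetzGroupBaseChange_map_toComplexAlg_eq hx' hg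

/-- **The degree-two Hodge classes are fixed by `S(H)(ℚ)`** (odd weight): for `y ∈ B¹ = Hdgⁿ(⋀² H)` and `g ∈ S(H)(ℚ)`,
`⋀²(g) y = y` — the divisor-type `2`-forms `e_D` are fixed by Milne's group (here on its rational points).
[cite: Milne1999LefschetzClasses, §4 Thm. 4.4 (proof, p. 659: "`(γ, γ†γ)` fixes `e_D`") and Cor. 4.5] -/
theorem Polarization.exteriorPower_map_eq_of_mem_lefschetzGroup_of_mem_hodgeClasses_two (hn : Odd n) {y : ⋀[ℚ]^2 V}
    (hy : y ∈ (H.exteriorPower 2).hodgeClasses n) {g : V ≃ₗ[ℚ] V} (hg : g ∈ Q.lefschetzGroup) :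
    exteriorPower.map 2 (g : V →ₗ[ℚ] V) y = y := by
  refine Subtype.ext ?_
  rw [coe_exteriorPower_map]
  refine Q.map_eq_of_mem_lefschetzGroup_of_forall_lefschetzGroupBaseChange_map_toComplexAlg_eq (fun γ hγ ↦ ?_) hg
  have h1 : (y : ExteriorAlgebra ℚ V) ∈ Submodule.span ℚ {y : ExteriorAlgebra ℚ V | y ∈ ⋀[ℚ]^2 V ∧ ∃ a ∈ H.endAlg,
      Q.adjoint a = a ∧ ∀ v w, contractionForm y (Q.form v) (Q.form w) = Q.form (a v) w} ^ 1 := by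
    rw [pow_one, Q.span_divisorTwoVectors_eq_map_hodgeClasses hn]
    exact ⟨y, hy, rfl⟩
  exact Q.forall_lefschetzGroupBaseChange_map_toComplexAlg_eq_of_mem_span_pow hn 1 h1 γ hγ

end HodgeStructure

end Literature.AlgebraicGeometry.Motives
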